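import Mathlib
import Summits.CriticalPhenomena.PercolationContinuityZ3.Theorems.PercNearOneGluingNoHeavyLowerTailOrientedAntipodalHallEnlargedTwoGroup

/-!
# Theorem O for the four 5-type classes on four petals (petal enlargement)

Helper file for crux `stmt-CriticalPhenomena-4575` (`NoHeavyLowerTail`, route `PercNearOneGluingNoHeavy`),
new-inequality factory seat `prim-ineq-gen-3` (gen 11).  Everything here is PROVED.

The four opposite-free 5-type classes on four petals `i, j, l, m` not covered by three-group certificates (memo FINDINGS-gen11.md F11-2)
are instances of the two-group count with petal enlargement `OrientedAntipodalHall.card_le_card_goods_above_of_enlarged_assignment`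
(enlargement petal `l`; certificates found by code-gen11/enlarge_search.py and checked numerically by cert_check.py):
* `card_le_card_goods_above_fiveC`: Theorem O (count), class C: types `(i,j), (i,l), (j,l), (l,m), (m,i)` (the triangle `i,j,l` with the path `l → m → i`).  Certificate: `Sig = {l}`, group one `D_{il}` complemented, group two `D_{jl}, D_{mi}` complemented before `D_{ij}, D_{lm}` plain.\n* `card_le_card_goods_above_fiveD`: Theorem O (count), class D = `TT₄` minus the arc `(j,m)`: types `(i,j), (i,l), (i,m), (j,l), (l,m)`.  Certificate: `Sig = {l}`, group one `D_{il}` complemented, group two `D_{jl}` complemented before `D_{ij}, D_{im}, D_{lm}` plain.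
With these, Conjecture O₄ (distinct good representatives above the bads of any opposite-free type set on four petals) is a theorem for
37 of the 41 classes; open: the four tournaments.  (prim-ineq-gen-3 gen 11, 2026-08-20.)
-/

namespace Summit.CriticalPhenomena.PercolationContinuityZ3.Theorems

namespace OrientedAntipodalHall

open Finset AntipodalStrongHarris AntipodalStrongHarris.Lab
open scoped FinsetFamily

variable {α : Type*} [DecidableEq α] {k : ℕ}

/-- **Theorem O (count), class C**: types `(i,j), (i,l), (j,l), (l,m), (m,i)` (the triangle `i,j,l` with the path `l → m → i`).  Certificate: `Sig = {l}`, group one `D_{il}` complemented, group two `D_{jl}, D_{mi}` complemented before `D_{ij}, D_{lm}` plain. -/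
theorem card_le_card_goods_above_fiveC (S : Finset α) {f : Finset α → Lab k}
    (hf : ∀ ⦃X Y : Finset α⦄, X ⊆ Y → f X ≤ f Y) (D₁ D₂ D₃ D₄ D₅ : Finset (Finset α)) {i j l m : Fin k}
    (hij : i ≠ j) (hil : i ≠ l) (him : i ≠ m) (hjl : j ≠ l) (hjm : j ≠ m) (hlm : l ≠ m)
    (h1S : ∀ X ∈ D₁, X ⊆ S) (h1a : ∀ X ∈ D₁, f X = petal i) (h1b : ∀ X ∈ D₁, f (S \ X) = petal j)
    (h2S : ∀ X ∈ D₂, X ⊆ S) (h2a : ∀ X ∈ D₂, f X = petal i) (h2b : ∀ X ∈ D₂, f (S \ X) = petal l)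
    (h3S : ∀ X ∈ D₃, X ⊆ S) (h3a : ∀ X ∈ D₃, f X = petal j) (h3b : ∀ X ∈ D₃, f (S \ X) = petal l)
    (h4S : ∀ X ∈ D₄, X ⊆ S) (h4a : ∀ X ∈ D₄, f X = petal l) (h4b : ∀ X ∈ D₄, f (S \ X) = petal m)
    (h5S : ∀ X ∈ D₅, X ⊆ S) (h5a : ∀ X ∈ D₅, f X = petal m) (h5b : ∀ X ∈ D₅, f (S \ X) = petal i)
    : #D₁ + #D₂ + #D₃ + #D₄ + #D₅ ≤
      #{U ∈ S.powerset | f U = top ∧ f (S \ U) = bot ∧ ∃ X ∈ D₁ ∪ D₂ ∪ D₃ ∪ D₄ ∪ D₅, X ⊆ U} := by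
  have pinj : ∀ {p q : Fin k}, (petal p : Lab k) = petal q → p = q := fun h => Lab.petal.inj h
  have d12 : ∀ X ∈ D₁, X ∉ D₂ := fun X h1 h2 => hjl (pinj ((h1b X h1).symm.trans (h2b X h2)))
  have d13 : ∀ X ∈ D₁, X ∉ D₃ := fun X h1 h2 => hij (pinj ((h1a X h1).symm.trans (h3a X h2)))
  have d14 : ∀ X ∈ D₁, X ∉ D₄ := fun X h1 h2 => hil (pinj ((h1a X h1).symm.trans (h4a X h2)))
  have d15 : ∀ X ∈ D₁, X ∉ D₅ := fun X h1 h2 => him (pinj ((h1a X h1).symm.trans (h5a X h2)))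
  have d23 : ∀ X ∈ D₂, X ∉ D₃ := fun X h1 h2 => hij (pinj ((h2a X h1).symm.trans (h3a X h2)))
  have d24 : ∀ X ∈ D₂, X ∉ D₄ := fun X h1 h2 => hil (pinj ((h2a X h1).symm.trans (h4a X h2)))
  have d25 : ∀ X ∈ D₂, X ∉ D₅ := fun X h1 h2 => him (pinj ((h2a X h1).symm.trans (h5a X h2)))
  have d34 : ∀ X ∈ D₃, X ∉ D₄ := fun X h1 h2 => hjl (pinj ((h3a X h1).symm.trans (h4a X h2)))
  have d35 : ∀ X ∈ D₃, X ∉ D₅ := fun X h1 h2 => hjm (pinj ((h3a X h1).symm.trans (h5a X h2)))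
  have d45 : ∀ X ∈ D₄, X ∉ D₅ := fun X h1 h2 => hlm (pinj ((h4a X h1).symm.trans (h5a X h2)))
  let cpl : Finset α → Bool := fun X => if X ∈ D₁ then false else if X ∈ D₂ then true else if X ∈ D₃ then true else if X ∈ D₄ then false else true
  let a : Finset α → Fin k := fun X => if X ∈ D₁ then i else if X ∈ D₂ then l else if X ∈ D₃ then l else if X ∈ D₄ then l else i
  let b : Finset α → Fin k := fun X => if X ∈ D₁ then j else if X ∈ D₂ then i else if X ∈ D₃ then j else if X ∈ D₄ then m else m
  have ev1 : ∀ X ∈ D₁, cpl X = false ∧ a X = i ∧ b X = j := by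
    intro X hX
    simp [cpl, a, b, hX]
  have ev2 : ∀ X ∈ D₂, cpl X = true ∧ a X = l ∧ b X = i := by
    intro X hX
    have n1 : X ∉ D₁ := fun h => d12 X h hX
    simp [cpl, a, b, hX, n1]
  have ev3 : ∀ X ∈ D₃, cpl X = true ∧ a X = l ∧ b X = j := by
    intro X hX
    have n1 : X ∉ D₁ := fun h => d13 X h hX
    have n2 : X ∉ D₂ := fun h => d23 X h hX
    simp [cpl, a, b, hX, n1, n2]
  have ev4 : ∀ X ∈ D₄, cpl X = false ∧ a X = l ∧ b X = m := by
    intro X hX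
    have n1 : X ∉ D₁ := fun h => d14 X h hX
    have n2 : X ∉ D₂ := fun h => d24 X h hX
    have n3 : X ∉ D₃ := fun h => d34 X h hX
    simp [cpl, a, b, hX, n1, n2, n3]
  have ev5 : ∀ X ∈ D₅, cpl X = true ∧ a X = i ∧ b X = m := by
    intro X hX
    have n1 : X ∉ D₁ := fun h => d15 X h hX
    have n2 : X ∉ D₂ := fun h => d25 X h hX
    have n3 : X ∉ D₃ := fun h => d35 X h hX
    have n4 : X ∉ D₄ := fun h => d45 X h hX
    simp [cpl, a, b, n1, n2, n3, n4]
  have hmain := card_le_card_goods_above_of_enlarged_assignment S hf D₂ (((D₁ ∪ D₃) ∪ D₄) ∪ D₅) cpl a b {l} ?_ ?_ ?_ ?_ ?_ ?_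
  · have hU : D₂ ∪ (((D₁ ∪ D₃) ∪ D₄) ∪ D₅) = D₁ ∪ D₂ ∪ D₃ ∪ D₄ ∪ D₅ := by
      ext X; simp only [mem_union]; tauto
    rw [hU] at hmain
    have hc0 : #D₂ = #D₂ := rfl
    have hc1 : #(((D₁ ∪ D₃) ∪ D₄) ∪ D₅) = #D₁ + #D₃ + #D₄ + #D₅ := by
      rw [card_union_of_disjoint (Finset.disjoint_left.mpr (fun X hX hX2 => by
        simp only [mem_union] at hX
        rcases hX with (h | h) | h
        · exact d15 X h hX2
        · exact d35 X h hX2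
        · exact d45 X h hX2
        ))]
      rw [card_union_of_disjoint (Finset.disjoint_left.mpr (fun X hX hX2 => by
        simp only [mem_union] at hX
        rcases hX with h | h
        · exact d14 X h hX2
        · exact d34 X h hX2
        ))]
      rw [card_union_of_disjoint (Finset.disjoint_left.mpr (fun X hX hX2 => by
        exact d13 X hX hX2))]
    rw [hc0, hc1] at hmain
    omega
  · intro X hX
    simp only [mem_union] at hX
    rcases hX with hX | (((hX | hX) | hX) | hX)
    · obtain ⟨hc, ha, hb⟩ := ev2 X hX
      refine ⟨h2S X hX, fun h => ?_, fun _ => ?_⟩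
      · rw [hc] at h; exact absurd h (by decide)
      · rw [ha, hb]; exact ⟨h2b X hX, h2a X hX⟩
    · obtain ⟨hc, ha, hb⟩ := ev1 X hX
      refine ⟨h1S X hX, fun _ => ?_, fun h => ?_⟩
      · rw [ha, hb]; exact ⟨h1a X hX, h1b X hX⟩
      · rw [hc] at h; exact absurd h (by decide)
    · obtain ⟨hc, ha, hb⟩ := ev3 X hX
      refine ⟨h3S X hX, fun h => ?_, fun _ => ?_⟩
      · rw [hc] at h; exact absurd h (by decide)
      · rw [ha, hb]; exact ⟨h3b X hX, h3a X hX⟩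
    · obtain ⟨hc, ha, hb⟩ := ev4 X hX
      refine ⟨h4S X hX, fun _ => ?_, fun h => ?_⟩
      · rw [ha, hb]; exact ⟨h4a X hX, h4b X hX⟩
      · rw [hc] at h; exact absurd h (by decide)
    · obtain ⟨hc, ha, hb⟩ := ev5 X hX
      refine ⟨h5S X hX, fun h => ?_, fun _ => ?_⟩
      · rw [hc] at h; exact absurd h (by decide)
      · rw [ha, hb]; exact ⟨h5b X hX, h5a X hX⟩
  · intro X hX
    simp only [mem_union] at hX
    rcases hX with hX | (((hX | hX) | hX) | hX)
    · obtain ⟨-, -, hb⟩ := ev2 X hX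
      rw [hb, mem_singleton]; exact hil
    · obtain ⟨-, -, hb⟩ := ev1 X hX
      rw [hb, mem_singleton]; exact hjl
    · obtain ⟨-, -, hb⟩ := ev3 X hX
      rw [hb, mem_singleton]; exact hjl
    · obtain ⟨-, -, hb⟩ := ev4 X hX
      rw [hb, mem_singleton]; exact hlm.symm
    · obtain ⟨-, -, hb⟩ := ev5 X hX
      rw [hb, mem_singleton]; exact hlm.symm
  · intro X hX
    obtain ⟨hc, ha, -⟩ := ev2 X hX
    rw [hc, ha]; exact ⟨rfl, mem_singleton_self _⟩
  · intro X hX X' hX'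
    obtain ⟨-, ha, hb⟩ := ev2 X hX; obtain ⟨-, ha', hb'⟩ := ev2 X' hX'
    rw [ha, hb, ha', hb']; exact ⟨hil.symm, hil⟩
  · intro X hX X' hX'
    simp only [mem_union] at hX hX'
    rcases hX with ((hX | hX) | hX) | hX <;> rcases hX' with ((hX' | hX') | hX') | hX'
    · obtain ⟨hc, ha, hb⟩ := ev1 X hX; obtain ⟨hc', ha', hb'⟩ := ev1 X' hX'
      rw [ha, hb, ha', hb']; exact ⟨hij, hij.symm, fun h => by rw [hc] at h; exact absurd h (by decide)⟩
    · obtain ⟨hc, ha, hb⟩ := ev1 X hX; obtain ⟨hc', ha', hb'⟩ := ev3 X' hX'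
      rw [ha, hb, ha', hb']; exact ⟨hij, hjl, fun h => by rw [hc] at h; exact absurd h (by decide)⟩
    · obtain ⟨hc, ha, hb⟩ := ev1 X hX; obtain ⟨hc', ha', hb'⟩ := ev4 X' hX'
      rw [ha, hb, ha', hb']; exact ⟨him, hjl, fun h => by rw [hc] at h; exact absurd h (by decide)⟩
    · obtain ⟨hc, ha, hb⟩ := ev1 X hX; obtain ⟨hc', ha', hb'⟩ := ev5 X' hX'
      rw [ha, hb, ha', hb']; exact ⟨him, hij.symm, fun h => by rw [hc] at h; exact absurd h (by decide)⟩
    · obtain ⟨hc, ha, hb⟩ := ev3 X hX; obtain ⟨hc', ha', hb'⟩ := ev1 X' hX'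
      rw [ha, hb, ha', hb']; exact ⟨hjl.symm, hij.symm, fun _ _ h => hil.symm h.1⟩
    · obtain ⟨hc, ha, hb⟩ := ev3 X hX; obtain ⟨hc', ha', hb'⟩ := ev3 X' hX'
      rw [ha, hb, ha', hb']; exact ⟨hjl.symm, hjl, fun _ h => by rw [hc'] at h; exact absurd h (by decide)⟩
    · obtain ⟨hc, ha, hb⟩ := ev3 X hX; obtain ⟨hc', ha', hb'⟩ := ev4 X' hX'
      rw [ha, hb, ha', hb']; exact ⟨hlm, hjl, fun _ _ h => hjm h.2⟩
    · obtain ⟨hc, ha, hb⟩ := ev3 X hX; obtain ⟨hc', ha', hb'⟩ := ev5 X' hX'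
      rw [ha, hb, ha', hb']; exact ⟨hlm, hij.symm, fun _ h => by rw [hc'] at h; exact absurd h (by decide)⟩
    · obtain ⟨hc, ha, hb⟩ := ev4 X hX; obtain ⟨hc', ha', hb'⟩ := ev1 X' hX'
      rw [ha, hb, ha', hb']; exact ⟨hjl.symm, him.symm, fun h => by rw [hc] at h; exact absurd h (by decide)⟩
    · obtain ⟨hc, ha, hb⟩ := ev4 X hX; obtain ⟨hc', ha', hb'⟩ := ev3 X' hX'
      rw [ha, hb, ha', hb']; exact ⟨hjl.symm, hlm.symm, fun h => by rw [hc] at h; exact absurd h (by decide)⟩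
    · obtain ⟨hc, ha, hb⟩ := ev4 X hX; obtain ⟨hc', ha', hb'⟩ := ev4 X' hX'
      rw [ha, hb, ha', hb']; exact ⟨hlm, hlm.symm, fun h => by rw [hc] at h; exact absurd h (by decide)⟩
    · obtain ⟨hc, ha, hb⟩ := ev4 X hX; obtain ⟨hc', ha', hb'⟩ := ev5 X' hX'
      rw [ha, hb, ha', hb']; exact ⟨hlm, him.symm, fun h => by rw [hc] at h; exact absurd h (by decide)⟩
    · obtain ⟨hc, ha, hb⟩ := ev5 X hX; obtain ⟨hc', ha', hb'⟩ := ev1 X' hX'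
      rw [ha, hb, ha', hb']; exact ⟨hij, him.symm, fun _ _ h => hjm.symm h.2⟩
    · obtain ⟨hc, ha, hb⟩ := ev5 X hX; obtain ⟨hc', ha', hb'⟩ := ev3 X' hX'
      rw [ha, hb, ha', hb']; exact ⟨hij, hlm.symm, fun _ h => by rw [hc'] at h; exact absurd h (by decide)⟩
    · obtain ⟨hc, ha, hb⟩ := ev5 X hX; obtain ⟨hc', ha', hb'⟩ := ev4 X' hX'
      rw [ha, hb, ha', hb']; exact ⟨him, hlm.symm, fun _ _ h => hil h.1⟩
    · obtain ⟨hc, ha, hb⟩ := ev5 X hX; obtain ⟨hc', ha', hb'⟩ := ev5 X' hX'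
      rw [ha, hb, ha', hb']; exact ⟨him, him.symm, fun _ h => by rw [hc'] at h; exact absurd h (by decide)⟩
  · intro X hX Y hY
    simp only [mem_union] at hY
    rcases hY with ((hY | hY) | hY) | hY
    · obtain ⟨-, ha, hb⟩ := ev2 X hX; obtain ⟨-, ha', hb'⟩ := ev1 Y hY
      rw [ha, hb, ha', hb']; exact ⟨hij, fun h => hjl.symm h.1⟩
    · obtain ⟨-, ha, hb⟩ := ev2 X hX; obtain ⟨-, ha', hb'⟩ := ev3 Y hY
      rw [ha, hb, ha', hb']; exact ⟨hij, fun h => hjl.symm h.1⟩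
    · obtain ⟨-, ha, hb⟩ := ev2 X hX; obtain ⟨-, ha', hb'⟩ := ev4 Y hY
      rw [ha, hb, ha', hb']; exact ⟨him, fun h => hlm h.1⟩
    · obtain ⟨-, ha, hb⟩ := ev2 X hX; obtain ⟨-, ha', hb'⟩ := ev5 Y hY
      rw [ha, hb, ha', hb']; exact ⟨him, fun h => hlm h.1⟩

/-- **Theorem O (count), class D = `TT₄` minus the arc `(j,m)`**: types `(i,j), (i,l), (i,m), (j,l), (l,m)`.  Certificate: `Sig = {l}`, group one `D_{il}` complemented, group two `D_{jl}` complemented before `D_{ij}, D_{im}, D_{lm}` plain. -/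
theorem card_le_card_goods_above_fiveD (S : Finset α) {f : Finset α → Lab k}
    (hf : ∀ ⦃X Y : Finset α⦄, X ⊆ Y → f X ≤ f Y) (D₁ D₂ D₃ D₄ D₅ : Finset (Finset α)) {i j l m : Fin k}
    (hij : i ≠ j) (hil : i ≠ l) (him : i ≠ m) (hjl : j ≠ l) (hjm : j ≠ m) (hlm : l ≠ m)
    (h1S : ∀ X ∈ D₁, X ⊆ S) (h1a : ∀ X ∈ D₁, f X = petal i) (h1b : ∀ X ∈ D₁, f (S \ X) = petal j)
    (h2S : ∀ X ∈ D₂, X ⊆ S) (h2a : ∀ X ∈ D₂, f X = petal i) (h2b : ∀ X ∈ D₂, f (S \ X) = petal l)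
    (h3S : ∀ X ∈ D₃, X ⊆ S) (h3a : ∀ X ∈ D₃, f X = petal i) (h3b : ∀ X ∈ D₃, f (S \ X) = petal m)
    (h4S : ∀ X ∈ D₄, X ⊆ S) (h4a : ∀ X ∈ D₄, f X = petal j) (h4b : ∀ X ∈ D₄, f (S \ X) = petal l)
    (h5S : ∀ X ∈ D₅, X ⊆ S) (h5a : ∀ X ∈ D₅, f X = petal l) (h5b : ∀ X ∈ D₅, f (S \ X) = petal m)
    : #D₁ + #D₂ + #D₃ + #D₄ + #D₅ ≤
      #{U ∈ S.powerset | f U = top ∧ f (S \ U) = bot ∧ ∃ X ∈ D₁ ∪ D₂ ∪ D₃ ∪ D₄ ∪ D₅, X ⊆ U} := by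
  have pinj : ∀ {p q : Fin k}, (petal p : Lab k) = petal q → p = q := fun h => Lab.petal.inj h
  have d12 : ∀ X ∈ D₁, X ∉ D₂ := fun X h1 h2 => hjl (pinj ((h1b X h1).symm.trans (h2b X h2)))
  have d13 : ∀ X ∈ D₁, X ∉ D₃ := fun X h1 h2 => hjm (pinj ((h1b X h1).symm.trans (h3b X h2)))
  have d14 : ∀ X ∈ D₁, X ∉ D₄ := fun X h1 h2 => hij (pinj ((h1a X h1).symm.trans (h4a X h2)))
  have d15 : ∀ X ∈ D₁, X ∉ D₅ := fun X h1 h2 => hil (pinj ((h1a X h1).symm.trans (h5a X h2)))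
  have d23 : ∀ X ∈ D₂, X ∉ D₃ := fun X h1 h2 => hlm (pinj ((h2b X h1).symm.trans (h3b X h2)))
  have d24 : ∀ X ∈ D₂, X ∉ D₄ := fun X h1 h2 => hij (pinj ((h2a X h1).symm.trans (h4a X h2)))
  have d25 : ∀ X ∈ D₂, X ∉ D₅ := fun X h1 h2 => hil (pinj ((h2a X h1).symm.trans (h5a X h2)))
  have d34 : ∀ X ∈ D₃, X ∉ D₄ := fun X h1 h2 => hij (pinj ((h3a X h1).symm.trans (h4a X h2)))
  have d35 : ∀ X ∈ D₃, X ∉ D₅ := fun X h1 h2 => hil (pinj ((h3a X h1).symm.trans (h5a X h2)))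
  have d45 : ∀ X ∈ D₄, X ∉ D₅ := fun X h1 h2 => hjl (pinj ((h4a X h1).symm.trans (h5a X h2)))
  let cpl : Finset α → Bool := fun X => if X ∈ D₁ then false else if X ∈ D₂ then true else if X ∈ D₃ then false else if X ∈ D₄ then true else false
  let a : Finset α → Fin k := fun X => if X ∈ D₁ then i else if X ∈ D₂ then l else if X ∈ D₃ then i else if X ∈ D₄ then l else l
  let b : Finset α → Fin k := fun X => if X ∈ D₁ then j else if X ∈ D₂ then i else if X ∈ D₃ then m else if X ∈ D₄ then j else m
  have ev1 : ∀ X ∈ D₁, cpl X = false ∧ a X = i ∧ b X = j := by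
    intro X hX
    simp [cpl, a, b, hX]
  have ev2 : ∀ X ∈ D₂, cpl X = true ∧ a X = l ∧ b X = i := by
    intro X hX
    have n1 : X ∉ D₁ := fun h => d12 X h hX
    simp [cpl, a, b, hX, n1]
  have ev3 : ∀ X ∈ D₃, cpl X = false ∧ a X = i ∧ b X = m := by
    intro X hX
    have n1 : X ∉ D₁ := fun h => d13 X h hX
    have n2 : X ∉ D₂ := fun h => d23 X h hX
    simp [cpl, a, b, hX, n1, n2]
  have ev4 : ∀ X ∈ D₄, cpl X = true ∧ a X = l ∧ b X = j := by
    intro X hX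
    have n1 : X ∉ D₁ := fun h => d14 X h hX
    have n2 : X ∉ D₂ := fun h => d24 X h hX
    have n3 : X ∉ D₃ := fun h => d34 X h hX
    simp [cpl, a, b, hX, n1, n2, n3]
  have ev5 : ∀ X ∈ D₅, cpl X = false ∧ a X = l ∧ b X = m := by
    intro X hX
    have n1 : X ∉ D₁ := fun h => d15 X h hX
    have n2 : X ∉ D₂ := fun h => d25 X h hX
    have n3 : X ∉ D₃ := fun h => d35 X h hX
    have n4 : X ∉ D₄ := fun h => d45 X h hX
    simp [cpl, a, b, n1, n2, n3, n4]
  have hmain := card_le_card_goods_above_of_enlarged_assignment S hf D₂ (((D₁ ∪ D₃) ∪ D₄) ∪ D₅) cpl a b {l} ?_ ?_ ?_ ?_ ?_ ?_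
  · have hU : D₂ ∪ (((D₁ ∪ D₃) ∪ D₄) ∪ D₅) = D₁ ∪ D₂ ∪ D₃ ∪ D₄ ∪ D₅ := by
      ext X; simp only [mem_union]; tauto
    rw [hU] at hmain
    have hc0 : #D₂ = #D₂ := rfl
    have hc1 : #(((D₁ ∪ D₃) ∪ D₄) ∪ D₅) = #D₁ + #D₃ + #D₄ + #D₅ := by
      rw [card_union_of_disjoint (Finset.disjoint_left.mpr (fun X hX hX2 => by
        simp only [mem_union] at hX
        rcases hX with (h | h) | h
        · exact d15 X h hX2
        · exact d35 X h hX2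
        · exact d45 X h hX2
        ))]
      rw [card_union_of_disjoint (Finset.disjoint_left.mpr (fun X hX hX2 => by
        simp only [mem_union] at hX
        rcases hX with h | h
        · exact d14 X h hX2
        · exact d34 X h hX2
        ))]
      rw [card_union_of_disjoint (Finset.disjoint_left.mpr (fun X hX hX2 => by
        exact d13 X hX hX2))]
    rw [hc0, hc1] at hmain
    omega
  · intro X hX
    simp only [mem_union] at hX
    rcases hX with hX | (((hX | hX) | hX) | hX)
    · obtain ⟨hc, ha, hb⟩ := ev2 X hX
      refine ⟨h2S X hX, fun h => ?_, fun _ => ?_⟩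
      · rw [hc] at h; exact absurd h (by decide)
      · rw [ha, hb]; exact ⟨h2b X hX, h2a X hX⟩
    · obtain ⟨hc, ha, hb⟩ := ev1 X hX
      refine ⟨h1S X hX, fun _ => ?_, fun h => ?_⟩
      · rw [ha, hb]; exact ⟨h1a X hX, h1b X hX⟩
      · rw [hc] at h; exact absurd h (by decide)
    · obtain ⟨hc, ha, hb⟩ := ev3 X hX
      refine ⟨h3S X hX, fun _ => ?_, fun h => ?_⟩
      · rw [ha, hb]; exact ⟨h3a X hX, h3b X hX⟩
      · rw [hc] at h; exact absurd h (by decide)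
    · obtain ⟨hc, ha, hb⟩ := ev4 X hX
      refine ⟨h4S X hX, fun h => ?_, fun _ => ?_⟩
      · rw [hc] at h; exact absurd h (by decide)
      · rw [ha, hb]; exact ⟨h4b X hX, h4a X hX⟩
    · obtain ⟨hc, ha, hb⟩ := ev5 X hX
      refine ⟨h5S X hX, fun _ => ?_, fun h => ?_⟩
      · rw [ha, hb]; exact ⟨h5a X hX, h5b X hX⟩
      · rw [hc] at h; exact absurd h (by decide)
  · intro X hX
    simp only [mem_union] at hX
    rcases hX with hX | (((hX | hX) | hX) | hX)
    · obtain ⟨-, -, hb⟩ := ev2 X hX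
      rw [hb, mem_singleton]; exact hil
    · obtain ⟨-, -, hb⟩ := ev1 X hX
      rw [hb, mem_singleton]; exact hjl
    · obtain ⟨-, -, hb⟩ := ev3 X hX
      rw [hb, mem_singleton]; exact hlm.symm
    · obtain ⟨-, -, hb⟩ := ev4 X hX
      rw [hb, mem_singleton]; exact hjl
    · obtain ⟨-, -, hb⟩ := ev5 X hX
      rw [hb, mem_singleton]; exact hlm.symm
  · intro X hX
    obtain ⟨hc, ha, -⟩ := ev2 X hX
    rw [hc, ha]; exact ⟨rfl, mem_singleton_self _⟩
  · intro X hX X' hX'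
    obtain ⟨-, ha, hb⟩ := ev2 X hX; obtain ⟨-, ha', hb'⟩ := ev2 X' hX'
    rw [ha, hb, ha', hb']; exact ⟨hil.symm, hil⟩
  · intro X hX X' hX'
    simp only [mem_union] at hX hX'
    rcases hX with ((hX | hX) | hX) | hX <;> rcases hX' with ((hX' | hX') | hX') | hX'
    · obtain ⟨hc, ha, hb⟩ := ev1 X hX; obtain ⟨hc', ha', hb'⟩ := ev1 X' hX'
      rw [ha, hb, ha', hb']; exact ⟨hij, hij.symm, fun h => by rw [hc] at h; exact absurd h (by decide)⟩
    · obtain ⟨hc, ha, hb⟩ := ev1 X hX; obtain ⟨hc', ha', hb'⟩ := ev3 X' hX'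
      rw [ha, hb, ha', hb']; exact ⟨him, hij.symm, fun h => by rw [hc] at h; exact absurd h (by decide)⟩
    · obtain ⟨hc, ha, hb⟩ := ev1 X hX; obtain ⟨hc', ha', hb'⟩ := ev4 X' hX'
      rw [ha, hb, ha', hb']; exact ⟨hij, hjl, fun h => by rw [hc] at h; exact absurd h (by decide)⟩
    · obtain ⟨hc, ha, hb⟩ := ev1 X hX; obtain ⟨hc', ha', hb'⟩ := ev5 X' hX'
      rw [ha, hb, ha', hb']; exact ⟨him, hjl, fun h => by rw [hc] at h; exact absurd h (by decide)⟩
    · obtain ⟨hc, ha, hb⟩ := ev3 X hX; obtain ⟨hc', ha', hb'⟩ := ev1 X' hX'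
      rw [ha, hb, ha', hb']; exact ⟨hij, him.symm, fun h => by rw [hc] at h; exact absurd h (by decide)⟩
    · obtain ⟨hc, ha, hb⟩ := ev3 X hX; obtain ⟨hc', ha', hb'⟩ := ev3 X' hX'
      rw [ha, hb, ha', hb']; exact ⟨him, him.symm, fun h => by rw [hc] at h; exact absurd h (by decide)⟩
    · obtain ⟨hc, ha, hb⟩ := ev3 X hX; obtain ⟨hc', ha', hb'⟩ := ev4 X' hX'
      rw [ha, hb, ha', hb']; exact ⟨hij, hlm.symm, fun h => by rw [hc] at h; exact absurd h (by decide)⟩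
    · obtain ⟨hc, ha, hb⟩ := ev3 X hX; obtain ⟨hc', ha', hb'⟩ := ev5 X' hX'
      rw [ha, hb, ha', hb']; exact ⟨him, hlm.symm, fun h => by rw [hc] at h; exact absurd h (by decide)⟩
    · obtain ⟨hc, ha, hb⟩ := ev4 X hX; obtain ⟨hc', ha', hb'⟩ := ev1 X' hX'
      rw [ha, hb, ha', hb']; exact ⟨hjl.symm, hij.symm, fun _ _ h => hil.symm h.1⟩
    · obtain ⟨hc, ha, hb⟩ := ev4 X hX; obtain ⟨hc', ha', hb'⟩ := ev3 X' hX'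
      rw [ha, hb, ha', hb']; exact ⟨hlm, hij.symm, fun _ _ h => hil.symm h.1⟩
    · obtain ⟨hc, ha, hb⟩ := ev4 X hX; obtain ⟨hc', ha', hb'⟩ := ev4 X' hX'
      rw [ha, hb, ha', hb']; exact ⟨hjl.symm, hjl, fun _ h => by rw [hc'] at h; exact absurd h (by decide)⟩
    · obtain ⟨hc, ha, hb⟩ := ev4 X hX; obtain ⟨hc', ha', hb'⟩ := ev5 X' hX'
      rw [ha, hb, ha', hb']; exact ⟨hlm, hjl, fun _ _ h => hjm h.2⟩
    · obtain ⟨hc, ha, hb⟩ := ev5 X hX; obtain ⟨hc', ha', hb'⟩ := ev1 X' hX'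
      rw [ha, hb, ha', hb']; exact ⟨hjl.symm, him.symm, fun h => by rw [hc] at h; exact absurd h (by decide)⟩
    · obtain ⟨hc, ha, hb⟩ := ev5 X hX; obtain ⟨hc', ha', hb'⟩ := ev3 X' hX'
      rw [ha, hb, ha', hb']; exact ⟨hlm, him.symm, fun h => by rw [hc] at h; exact absurd h (by decide)⟩
    · obtain ⟨hc, ha, hb⟩ := ev5 X hX; obtain ⟨hc', ha', hb'⟩ := ev4 X' hX'
      rw [ha, hb, ha', hb']; exact ⟨hjl.symm, hlm.symm, fun h => by rw [hc] at h; exact absurd h (by decide)⟩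
    · obtain ⟨hc, ha, hb⟩ := ev5 X hX; obtain ⟨hc', ha', hb'⟩ := ev5 X' hX'
      rw [ha, hb, ha', hb']; exact ⟨hlm, hlm.symm, fun h => by rw [hc] at h; exact absurd h (by decide)⟩
  · intro X hX Y hY
    simp only [mem_union] at hY
    rcases hY with ((hY | hY) | hY) | hY
    · obtain ⟨-, ha, hb⟩ := ev2 X hX; obtain ⟨-, ha', hb'⟩ := ev1 Y hY
      rw [ha, hb, ha', hb']; exact ⟨hij, fun h => hjl.symm h.1⟩
    · obtain ⟨-, ha, hb⟩ := ev2 X hX; obtain ⟨-, ha', hb'⟩ := ev3 Y hY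
      rw [ha, hb, ha', hb']; exact ⟨him, fun h => hlm h.1⟩
    · obtain ⟨-, ha, hb⟩ := ev2 X hX; obtain ⟨-, ha', hb'⟩ := ev4 Y hY
      rw [ha, hb, ha', hb']; exact ⟨hij, fun h => hjl.symm h.1⟩
    · obtain ⟨-, ha, hb⟩ := ev2 X hX; obtain ⟨-, ha', hb'⟩ := ev5 Y hY
      rw [ha, hb, ha', hb']; exact ⟨him, fun h => hlm h.1⟩
end OrientedAntipodalHall

end Summit.CriticalPhenomena.PercolationContinuityZ3.Theorems
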